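import Mathlib.LinearAlgebra.Matrix.Adjugate
import Mathlib.LinearAlgebra.Matrix.NonsingularInverse
import Mathlib.Algebra.Order.BigOperators.Group.Finset
import Mathlib.Algebra.Order.BigOperators.Ring.Finset
import Mathlib.Tactic.Linarith
import Mathlib.Tactic.Positivity
import Mathlib.Tactic.Ring

/-!
# Route «KPlusLogSqLaw», crux `TropicalB` (stmt-ValiantsHypothesis-19771) — SPARSE CRAMER: determinants and Cramer vectors of integer matrices
# with small row `ℓ¹`-norms

HONEST FRAMING.  Helper toward the registered stubs `stub_tropThin` / `stub_tropFat` of `Cruxes/TropicalB/Lines/birth.lean` (crux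
`Summit.ValiantsHypothesis.ValiantsHypothesis.Theses.KPlusLogSqLaw.TropicalB`, item stmt-ValiantsHypothesis-19771, route KPlusLogSqLaw; cell
`pub-symmetroid`, seat val-sym-trop-p1 g25, 2026-08-29; `--supports … --as helper`).  Pure linear algebra (Mathlib only), the size control behind the
EXPONENT-FREE cycle potential law (`…TropicalBCompatiblePotentialHeight`: a `c`-compatible class potential of height `≤ (2c+1)^K` for EVERY exponent
vector).  Nothing here is about `TropicalB` itself; nothing bears on `WeakLifting`, DoorA26 / DoorA34, `MatrixDescartes` (stmt-ValiantsHypothesis-18050) or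
VP ≠ VNP.

* `abs_det_le_prod_colSum`, `abs_det_le_prod_rowSum` — `|det M| ≤ ∏_j Σ_i |M i j|` and `≤ ∏_i Σ_j |M i j|` (expand Leibniz, keep all functions instead of
  permutations).  Weaker than Hadamard in general, but EXACTLY what sparse integer rows need: rows with `ℓ¹`-norm `≤ R` give `|det| ≤ R^n` — no `n!`.
* `rowSum_updateCol_le` / `abs_cramer_le_pow` — if every row of `M` has `ℓ¹`-norm `≤ R` and `|b j| ≤ 1`, then `|cramer M b i| ≤ (R+1)^n`.
* `cast_cramer` — Cramer vectors commute with the cast `ℤ → ℚ`; `cramer_eq_det_smul_of_mulVec_eq` — over a field, if `A` is nonsingular and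
  `A *ᵥ x = b` then `cramer A b = det A • x` (so `x = cramer / det`: integrality and size of vertices of integer polyhedra).
[folklore: Leibniz expansion bound; Cramer's rule]
-/

set_option linter.dupNamespace false
set_option autoImplicit false

namespace Summit.ValiantsHypothesis.ValiantsHypothesis.Theorems.KPlusLogSqLaw

open scoped BigOperators
open Finset Matrix

namespace SparseCramer

variable {n : Type*} [Fintype n] [DecidableEq n]

/-- **Leibniz bound by column `ℓ¹`-norms**: `|det M| ≤ ∏_j Σ_i |M i j|` for an integer matrix. [folklore] -/
theorem abs_det_le_prod_colSum (M : Matrix n n ℤ) : |M.det| ≤ ∏ j, ∑ i, |M i j| := by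
  classical
  rw [det_apply]
  calc |∑ σ : Equiv.Perm n, Equiv.Perm.sign σ • ∏ i, M (σ i) i|
      ≤ ∑ σ : Equiv.Perm n, |Equiv.Perm.sign σ • ∏ i, M (σ i) i| := abs_sum_le_sum_abs _ _
    _ = ∑ σ : Equiv.Perm n, ∏ i, |M (σ i) i| := by
        refine sum_congr rfl fun σ _ => ?_
        have h1 : |((Equiv.Perm.sign σ : ℤˣ) : ℤ)| = 1 := by
          rcases Int.units_eq_one_or (Equiv.Perm.sign σ) with h | h <;> simp [h]
        rw [Units.smul_def, smul_eq_mul, abs_mul, h1, one_mul, Finset.abs_prod]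
    _ = ∑ f ∈ (univ : Finset (Equiv.Perm n)).image (fun σ : Equiv.Perm n => (σ : n → n)), ∏ i, |M (f i) i| := by
        rw [sum_image]
        intro σ _ τ _ h
        exact Equiv.ext (congrFun h)
    _ ≤ ∑ f : n → n, ∏ i, |M (f i) i| :=
        sum_le_sum_of_subset_of_nonneg (subset_univ _) fun f _ _ => prod_nonneg fun i _ => abs_nonneg _
    _ = ∏ j, ∑ i, |M i j| := by
        rw [Fintype.prod_sum (fun j i => |M i j|)]

/-- **Leibniz bound by row `ℓ¹`-norms**: `|det M| ≤ ∏_i Σ_j |M i j|`. [folklore] -/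
theorem abs_det_le_prod_rowSum (M : Matrix n n ℤ) : |M.det| ≤ ∏ i, ∑ j, |M i j| := by
  rw [← det_transpose]
  exact abs_det_le_prod_colSum Mᵀ

/-- replacing one column by a vector with entries of absolute value `≤ 1` raises each row `ℓ¹`-norm by at most `1`. [folklore] -/
theorem rowSum_updateCol_le (M : Matrix n n ℤ) (R : ℤ) (hM : ∀ i, ∑ j, |M i j| ≤ R) (b : n → ℤ) (hb : ∀ i, |b i| ≤ 1)
    (k i : n) : ∑ j, |(M.updateCol k b) i j| ≤ R + 1 := by
  calc ∑ j, |(M.updateCol k b) i j| ≤ ∑ j, (|M i j| + if j = k then |b i| else 0) := by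
        refine sum_le_sum fun j _ => ?_
        rw [updateCol_apply]
        split_ifs with h
        · linarith [abs_nonneg (M i j)]
        · linarith
    _ = (∑ j, |M i j|) + |b i| := by rw [sum_add_distrib, sum_ite_eq' univ k, if_pos (mem_univ _)]
    _ ≤ R + 1 := add_le_add (hM i) (hb i)

/-- **Sparse Cramer bound**: if every row of the integer matrix `M` has `ℓ¹`-norm `≤ R` and `|b i| ≤ 1`, then every Cramer numerator
satisfies `|cramer M b k| ≤ (R + 1)^n`. [folklore] -/
theorem abs_cramer_le_pow (M : Matrix n n ℤ) (R : ℤ) (hM : ∀ i, ∑ j, |M i j| ≤ R) (b : n → ℤ) (hb : ∀ i, |b i| ≤ 1)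
    (k : n) : |M.cramer b k| ≤ (R + 1) ^ Fintype.card n := by
  rw [cramer_apply]
  calc |(M.updateCol k b).det| ≤ ∏ i, ∑ j, |(M.updateCol k b) i j| := abs_det_le_prod_rowSum _
    _ ≤ ∏ _i : n, (R + 1) :=
        prod_le_prod (fun i _ => sum_nonneg fun j _ => abs_nonneg _) fun i _ => rowSum_updateCol_le M R hM b hb k i
    _ = (R + 1) ^ Fintype.card n := by rw [prod_const, card_univ]

/-- Cramer vectors commute with the cast `ℤ → ℚ`. [folklore] -/
theorem cast_cramer (M : Matrix n n ℤ) (b : n → ℤ) (k : n) :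
    ((M.cramer b k : ℤ) : ℚ) = (M.map (Int.cast : ℤ → ℚ)).cramer (fun i => (b i : ℚ)) k := by
  rw [cramer_apply, cramer_apply]
  have h := (Int.castRingHom ℚ).map_det (M.updateCol k b)
  rw [RingHom.mapMatrix_apply, map_updateCol] at h
  rw [eq_intCast] at h
  rw [h]
  rfl

/-- the determinant commutes with the cast `ℤ → ℚ`. [folklore] -/
theorem cast_det (M : Matrix n n ℤ) : ((M.det : ℤ) : ℚ) = (M.map (Int.cast : ℤ → ℚ)).det := by
  have h := (Int.castRingHom ℚ).map_det M
  rw [RingHom.mapMatrix_apply, eq_intCast] at h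
  rw [h]
  rfl

/-- **Cramer's rule read backwards**: over a field, if `det A ≠ 0` and `A *ᵥ x = b`, then `cramer A b = det A • x`. [folklore] -/
theorem cramer_eq_det_smul_of_mulVec_eq {𝕜 : Type*} [Field 𝕜] (A : Matrix n n 𝕜) (hA : A.det ≠ 0) {x b : n → 𝕜}
    (hx : A *ᵥ x = b) : A.cramer b = A.det • x := by
  have hinj : Function.Injective A.mulVec := mulVec_injective_iff_isUnit.2 ((isUnit_iff_isUnit_det A).2 (isUnit_iff_ne_zero.2 hA))
  apply hinj
  rw [mulVec_cramer, mulVec_smul, hx]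

end SparseCramer

end Summit.ValiantsHypothesis.ValiantsHypothesis.Theorems.KPlusLogSqLaw
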